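import Mathlib.CategoryTheory.Adjunction.Mates
import Mathlib.CategoryTheory.Comma.Over.Pullback
import Literature.AnabelianGeometry.SemiGraphs.PullbackFunctor
import Literature.AnabelianGeometry.SemiGraphs.HomComposition
import Literature.AnabelianGeometry.SemiGraphs.BObjFunctors
import Literature.AnabelianGeometry.SemiGraphs.Coverticial
import HarnessLib

/-!
# Composites of finite étale coverings of semi-graphs of anabelioids: the pull-back functor and the
# global clause `B(𝒢'') ≃ B(𝒢)_{/C}` ([SemiAnbd] §2, Def. 2.2 (i) / Rmk. 2.4.2 / Rmk. 2.11.1)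

Mochizuki, *Semi-graphs of anabelioids*, Publ. RIMS **42** (2006) 221–322, §2: Remark 2.4.2 p. 26
(1-morphisms of semi-graphs of anabelioids "form a category"), Remark 2.11.1 p. 32 (a morphism
"determines, in a natural fashion, a morphism `B(𝒢) → B(ℋ)`"), Definition 2.2 (i) p. 23 (the finite
étale covering attached to an object of `B(𝒢)`: "`B' = B(𝒢)_{G'}` … arises naturally as the `B(−)` of
some … `𝒢'`"). [cite: MochizukiSemiAnbd2006, Rem. 2.11.1 p.32] [cite: MochizukiSemiAnbd2006, Def. 2.2(i) p.23]

abc-iut cell, F wave (FACT-LIST row F-1478, seat abc-iut-f-161).  The named fact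
`remark_2_4_1_covering` ([SemiAnbd] Rmk. 2.4.1) is reduced in the tree to the stability of print's
finite étale coverings — `Hom.IsFiniteEtaleCoveringGlobal` = local description ∧ global clause ∧
branch-aligned ∧ vertex-aligned — under the composition `Hom.comp` of `HomComposition.lean`
(`remark_2_4_1_covering_of_comp_isFiniteEtaleCoveringGlobal`, `CoverticialRemark241OfComp.lean`).  This
file supplies the first two pieces of that closure, for ARBITRARY 1-morphisms `φ : 𝒢 → ℋ`,
`ψ : ℋ → 𝒦`:

* `Hom.gluingIso_comp_hom_app` — the gluing isomorphism of the pull-back `(ψ ∘ φ)^* A` along a branch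
  agrees with that of the iterated pull-back `φ^*(ψ^* A)` (the pasted 2-cell `(ψ ∘ φ)_b` of Rmk. 2.4.2
  unwinds to `φ_b`, then `φ_e^*` of `ψ_{φ b}`); proved over an arbitrary presentation of the
  intermediate edges (`HomOver.gluingIso_comp_aux`, by `subst`), as in `HomCompositionLaws.lean`;
* `Hom.compPullbackIso : (φ.comp ψ).pullbackFunctor ≅ ψ.pullbackFunctor ⋙ φ.pullbackFunctor` —
  **functoriality of `B(−)`** ("determines, in a natural fashion", Rmk. 2.11.1): the identity on vertex
  and edge objects;
* `starEquivStarIso` — pure category theory: for an equivalence `α : Over A ⥤ D` and `B ∈ D`,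
  `(A × −) ⋙ α ⋙ (B × −) ≅ (C × −) ⋙ E` with `C := (α⁻¹ B).left` and `E : Over C ⥤ Over B` the
  equivalence "iterated slice, then `α`" — by uniqueness of right adjoints (`conjugateIsoEquiv`), the
  left adjoints `forget B ⋙ α⁻¹ ⋙ forget A` and `E⁻¹ ⋙ forget C` being EQUAL;
* `Hom.IsGlobalCoveringOf.comp` — **the global clause composes**: if `B(𝒢) ≃ B(ℋ)_{/B}` via `φ^*`
  and `B(ℋ) ≃ B(𝒦)_{/A}` via `ψ^*`, then `B(𝒢) ≃ B(𝒦)_{/C}` via `(ψ ∘ φ)^*` for some `C ∈ B(𝒦)`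
  (namely the object of `B(𝒦)` underlying `B` read in `B(𝒦)_{/A}`; print: "`B(𝒢)_{G'}` is a
  connected anabelioid over `B(𝒢)`, hence over anything `B(𝒢)` is finite étale over").

Also recorded: the underlying morphism of semi-graphs of a composite of coverings is proper
(`SemiGraph.IsProper.comp`, `Hom.IsFiniteEtaleCoveringOf.isProper_comp`).

Honest framing: the LOCAL description (`Hom.IsFiniteEtaleCoveringOf`) and the two ALIGNMENT clauses of
a composite are NOT proved here — they are the remaining residual of F-1478 (the local clause of the
composite needs a compatibility between the global equivalence of `ψ` and its local equivalences at the
vertices; the alignment clauses need the injectivity of `Π_{𝒢'} → Π_𝒢`, in the tree only for connected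
coverings, (D1)).  No definition of a named `Prop`; the two `def`s are canonical isomorphisms (data).
Nothing here takes a side on [IUTchIII] Cor. 3.12.
-/

namespace Literature.AnabelianGeometry.SemiGraphs

open CategoryTheory CategoryTheory.Limits

universe v₁ u₁ u

/-! ### Proper morphisms of semi-graphs compose -/

/-- Proper morphisms of semi-graphs (verticial cardinalities of edges are preserved, [SemiAnbd] §1
p. 14) are stable under composition. [cite: MochizukiSemiAnbd2006, §1 p.14] -/
theorem SemiGraph.IsProper.comp {G₁ G₂ G₃ : SemiGraph.{u}} {f : G₁ ⟶ G₂} {g : G₂ ⟶ G₃}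
    (hf : SemiGraph.IsProper f) (hg : SemiGraph.IsProper g) : SemiGraph.IsProper (f ≫ g) :=
  fun e => (hg (f.edgeMap e)).trans (hf e)

namespace SemiGraphOfAnabelioids

variable {𝒢 ℋ 𝒦 : SemiGraphOfAnabelioids.{v₁, u₁, u}}

/-! ### The gluing of a composite pull-back, over an arbitrary presentation of the edges -/

section Aux

variable {f : 𝒢.graph ⟶ ℋ.graph} {g : ℋ.graph ⟶ 𝒦.graph}

/-- The gluing of `(ψ ∘ φ)^* A` along a branch, computed from the pasted 2-cell
`HomOver.compCell` over an ARBITRARY presentation `e₁`, `e₂` of the intermediate and final edges,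
equals `φ_b`, then `φ_e^*` of the gluing of `ψ^* A` along `f b` (by `subst`, all re-indexing
isomorphisms become identities). [cite: MochizukiSemiAnbd2006, Rem. 2.11.1 p.32] -/
theorem HomOver.gluingIso_comp_aux (φ : HomOver 𝒢 ℋ f) (ψ : HomOver ℋ 𝒦 g)
    {e : 𝒢.graph.Edge} {v : 𝒢.graph.Vertex} (pG : Anabelioids.Hom (𝒢.E e) (𝒢.V v))
    (e₁ : ℋ.graph.Edge) (h₁ : f.edgeMap e = e₁)
    (pH : Anabelioids.Hom (ℋ.E e₁) (ℋ.V (f.vertexMap v)))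
    (e₂ : 𝒦.graph.Edge) (h₂ : g.edgeMap e₁ = e₂)
    (pK : Anabelioids.Hom (𝒦.E e₂) (𝒦.V (g.vertexMap (f.vertexMap v))))
    (α : (φ.φV v).pullback ⋙ pG.pullback ≅ pH.pullback ⋙ (φ.φE e e₁ h₁).pullback)
    (β : (ψ.φV (f.vertexMap v)).pullback ⋙ pH.pullback ≅ pK.pullback ⋙ (ψ.φE e₁ e₂ h₂).pullback)
    (A : 𝒦.BObj) (γ : pK.pullback.obj (A.S (g.vertexMap (f.vertexMap v))) ≅ A.T e₂) :
    (φ.compCell ψ pG e₁ h₁ pH e₂ h₂ pK α β).hom.app (A.S (g.vertexMap (f.vertexMap v))) ≫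
        (φ.compE ψ e e₂ (by rw [h₁, h₂])).pullback.map γ.hom ≫
          ((φ.comp ψ).toHom.reindexIso e e₂ ((f ≫ g).edgeMap e)
            (show g.edgeMap (f.edgeMap e) = e₂ by rw [h₁, h₂]) rfl).hom.app A =
      α.hom.app ((ψ.φV (f.vertexMap v)).pullback.obj (A.S (g.vertexMap (f.vertexMap v)))) ≫
        (φ.φE e e₁ h₁).pullback.map
          (β.hom.app (A.S (g.vertexMap (f.vertexMap v))) ≫ (ψ.φE e₁ e₂ h₂).pullback.map γ.hom ≫
            (ψ.toHom.reindexIso e₁ e₂ (g.edgeMap e₁) h₂ rfl).hom.app A) ≫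
          (φ.toHom.reindexIso e e₁ (f.edgeMap e) h₁ rfl).hom.app (ψ.toHom.pullbackFunctor.obj A) := by
  subst h₁
  subst h₂
  simp only [HomOver.compCell_hom_app, HomOver.compEIso_hom_app, Hom.reindexIso, eqToIso.hom,
    eqToHom_app, eqToHom_refl, Functor.map_comp, NatTrans.id_app]
  repeat (first
    | erw [eqToHom_refl]
    | erw [CategoryTheory.Functor.map_id]
    | erw [Category.id_comp]
    | erw [Category.comp_id])
  exact Category.assoc _ _ _

end Aux

/-- **The gluing of `(ψ ∘ φ)^* A` is the gluing of `φ^*(ψ^* A)`**: along a branch `b` of `𝒢` abutting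
to `v`, the gluing isomorphism of the pull-back of `A ∈ B(𝒦)` along the composite `φ.comp ψ` (built
from the pasted 2-cell `(ψ ∘ φ)_b`, Rmk. 2.4.2) coincides with that of the iterated pull-back (the
vertex and edge objects of the two agree definitionally). [cite: MochizukiSemiAnbd2006, Rem. 2.11.1 p.32] -/
theorem Hom.gluingIso_comp_hom_app (φ : Hom 𝒢 ℋ) (ψ : Hom ℋ 𝒦) (b : 𝒢.graph.Branch)
    (v : 𝒢.graph.Vertex) (h : 𝒢.graph.abuts b = some v) (A : 𝒦.BObj) :
    ((φ.comp ψ).gluingIso b v h).hom.app A =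
      (φ.gluingIso b v h).hom.app (ψ.pullbackFunctor.obj A) :=
  HomOver.gluingIso_comp_aux φ.over ψ.over (𝒢.pull b v h) (ℋ.graph.edgeOf (φ.base.branchMap b))
    (φ.base.edgeOf_branchMap b).symm
    (ℋ.pull (φ.base.branchMap b) (φ.base.vertexMap v) (φ.base.abuts_branchMap b v h))
    (𝒦.graph.edgeOf (ψ.base.branchMap (φ.base.branchMap b)))
    (ψ.base.edgeOf_branchMap (φ.base.branchMap b)).symm
    (𝒦.pull (ψ.base.branchMap (φ.base.branchMap b)) (ψ.base.vertexMap (φ.base.vertexMap v))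
      (ψ.base.abuts_branchMap _ _ (φ.base.abuts_branchMap b v h)))
    (φ.φB b v h) (ψ.φB (φ.base.branchMap b) (φ.base.vertexMap v) (φ.base.abuts_branchMap b v h))
    A (A.ψ (ψ.base.branchMap (φ.base.branchMap b)) (ψ.base.vertexMap (φ.base.vertexMap v))
      (ψ.base.abuts_branchMap _ _ (φ.base.abuts_branchMap b v h)))

/-! ### Functoriality of `B(−)`: the pull-back functor of a composite -/

/-- **`(ψ ∘ φ)^* ≅ ψ^* ⋙ φ^*` on `B(−)`** ([SemiAnbd] Rmk. 2.11.1: the morphism `B(𝒢) → B(𝒦)`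
determined "in a natural fashion" by a composite is the composite): the canonical isomorphism between
the pull-back functor `B(𝒦) ⥤ B(𝒢)` of `φ.comp ψ` and the composite of the pull-back functors, the
identity on vertex objects `φ_v^* ψ_{φ v}^* A_{ψ φ v}` and edge objects (the gluings agree by
`Hom.gluingIso_comp_hom_app`). [cite: MochizukiSemiAnbd2006, Rem. 2.11.1 p.32] -/
noncomputable def Hom.compPullbackIso (φ : Hom 𝒢 ℋ) (ψ : Hom ℋ 𝒦) :
    (φ.comp ψ).pullbackFunctor ≅ ψ.pullbackFunctor ⋙ φ.pullbackFunctor :=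
  NatIso.ofComponents
    (fun A => BObj.isoMk (fun _ => Iso.refl _) (fun _ => Iso.refl _) (fun b v h => by
      erw [CategoryTheory.Functor.map_id, Category.id_comp, Category.comp_id]
      exact (Hom.gluingIso_comp_hom_app φ ψ b v h A).symm))
    (fun g => by
      ext
      · dsimp only [BObj.comp_fS, BObj.isoMk_hom_fS, Iso.refl_hom]
        erw [Category.comp_id, Category.id_comp]
        rfl
      · dsimp only [BObj.comp_fT, BObj.isoMk_hom_fT, Iso.refl_hom]
        erw [Category.comp_id, Category.id_comp]
        rfl)

/-- Vertex components of `compPullbackIso` are identities. [cite: MochizukiSemiAnbd2006, Rem. 2.11.1 p.32] -/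
@[simp] theorem Hom.compPullbackIso_hom_app_fS (φ : Hom 𝒢 ℋ) (ψ : Hom ℋ 𝒦) (A : 𝒦.BObj)
    (v : 𝒢.graph.Vertex) : ((φ.compPullbackIso ψ).hom.app A).fS v = 𝟙 _ := rfl

/-- Edge components of `compPullbackIso` are identities. [cite: MochizukiSemiAnbd2006, Rem. 2.11.1 p.32] -/
@[simp] theorem Hom.compPullbackIso_hom_app_fT (φ : Hom 𝒢 ℋ) (ψ : Hom ℋ 𝒦) (A : 𝒦.BObj)
    (e : 𝒢.graph.Edge) : ((φ.compPullbackIso ψ).hom.app A).fT e = 𝟙 _ := rfl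

/-- Vertex components of the inverse of `compPullbackIso` are identities.
[cite: MochizukiSemiAnbd2006, Rem. 2.11.1 p.32] -/
@[simp] theorem Hom.compPullbackIso_inv_app_fS (φ : Hom 𝒢 ℋ) (ψ : Hom ℋ 𝒦) (A : 𝒦.BObj)
    (v : 𝒢.graph.Vertex) : ((φ.compPullbackIso ψ).inv.app A).fS v = 𝟙 _ := rfl

/-- Edge components of the inverse of `compPullbackIso` are identities.
[cite: MochizukiSemiAnbd2006, Rem. 2.11.1 p.32] -/
@[simp] theorem Hom.compPullbackIso_inv_app_fT (φ : Hom 𝒢 ℋ) (ψ : Hom ℋ 𝒦) (A : 𝒦.BObj)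
    (e : 𝒢.graph.Edge) : ((φ.compPullbackIso ψ).inv.app A).fT e = 𝟙 _ := rfl

/-! ### The global clause composes -/

section StarComp

variable {C D : Type*} [Category C] [Category D] [HasBinaryProducts C] [HasBinaryProducts D]

/-- **`(A × −)`, then an equivalence `α : C_{/A} ⥤ D`, then `(B × −)`, is `(C₀ × −)` followed by an
equivalence `C_{/C₀} ⥤ D_{/B}`**, where `C₀ := (α⁻¹ B).left` and the equivalence is "iterated slice
`C_{/C₀} ≌ (C_{/A})_{/α⁻¹ B}`, then `α`" (written through its inverse
`Over.post α⁻¹ ⋙ iteratedSliceEquiv`).  Proof: both sides are right adjoints (`forget ⊣ star`,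
equivalences) and the left adjoints `forget B ⋙ α⁻¹ ⋙ forget A`, `(post α⁻¹ ⋙ iteratedSlice) ⋙ forget C₀`
are equal, so `conjugateIsoEquiv` applies to the identity.  (The categorical content of "a finite
étale covering of a finite étale covering of `B(𝒢)` is a finite étale covering of `B(𝒢)`",
[SemiAnbd] p. 23.) [cite: MochizukiSemiAnbd2006, Def. 2.2(i) p.23] -/
noncomputable def starEquivStarIso (A : C) (α : Over A ⥤ D) [α.IsEquivalence] (B : D) :
    Over.star A ⋙ α ⋙ Over.star B ≅
      Over.star (α.inv.obj B).left ⋙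
        (Over.post α.inv ⋙ ((α.inv.obj B).iteratedSliceEquiv).functor).inv := by
  let G : Over B ⥤ Over (α.inv.obj B).left :=
    Over.post α.inv ⋙ ((α.inv.obj B).iteratedSliceEquiv).functor
  let adj₁ : (Over.forget B ⋙ α.inv) ⋙ Over.forget A ⊣ Over.star A ⋙ α ⋙ Over.star B :=
    ((Over.forgetAdjStar B).comp α.asEquivalence.symm.toAdjunction).comp (Over.forgetAdjStar A)
  let adj₂ : G ⋙ Over.forget (α.inv.obj B).left ⊣ Over.star (α.inv.obj B).left ⋙ G.inv :=
    G.asEquivalence.toAdjunction.comp (Over.forgetAdjStar _)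
  exact conjugateIsoEquiv adj₁ adj₂ (Iso.refl _)

end StarComp

/-- **The global clause of [SemiAnbd] Def. 2.2 (i) is stable under composition.**  If `φ : 𝒢 → ℋ`
satisfies `B(𝒢) ≃ B(ℋ)_{/B}` compatibly with `φ^*` (`Hom.IsGlobalCoveringOf φ B`) and `ψ : ℋ → 𝒦`
satisfies `B(ℋ) ≃ B(𝒦)_{/A}` compatibly with `ψ^*`, then the composite `φ.comp ψ : 𝒢 → 𝒦` satisfies
`B(𝒢) ≃ B(𝒦)_{/C}` compatibly with `(ψ ∘ φ)^*`, for `C` the object of `B(𝒦)` underlying `B` read in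
`B(𝒦)_{/A}` through the equivalence of `ψ`: `(ψ ∘ φ)^* ≅ ψ^* ⋙ φ^* ≅ (A × −) ⋙ α_ψ ⋙ (B × −) ⋙ α_φ
≅ (C × −) ⋙ (E ⋙ α_φ)` (`compPullbackIso`, `starEquivStarIso`).
[cite: MochizukiSemiAnbd2006, Def. 2.2(i) p.23] -/
theorem Hom.IsGlobalCoveringOf.comp {φ : Hom 𝒢 ℋ} {ψ : Hom ℋ 𝒦} {B : ℋ.BObj} {A : 𝒦.BObj}
    (hφ : φ.IsGlobalCoveringOf B) (hψ : ψ.IsGlobalCoveringOf A) :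
    ∃ C : 𝒦.BObj, (φ.comp ψ).IsGlobalCoveringOf C := by
  obtain ⟨instH, αφ, hαφ, ⟨eφ⟩⟩ := hφ
  obtain ⟨instK, αψ, hαψ, ⟨eψ⟩⟩ := hψ
  letI := instH
  letI := instK
  haveI := hαφ
  haveI := hαψ
  let G : Over B ⥤ Over (αψ.inv.obj B).left :=
    Over.post αψ.inv ⋙ ((αψ.inv.obj B).iteratedSliceEquiv).functor
  refine ⟨(αψ.inv.obj B).left, instK, G.inv ⋙ αφ, inferInstance, ⟨?_⟩⟩
  exact Hom.compPullbackIso φ ψ ≪≫ Functor.isoWhiskerRight eψ _ ≪≫ Functor.isoWhiskerLeft _ eφ ≪≫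
    Functor.isoWhiskerRight (starEquivStarIso A αψ B) αφ

/-- The proper-base conjunct of the local description composes: if `φ` and `ψ` are locally the
finite étale coverings attached to `B`, `A`, the underlying morphism of semi-graphs of `φ.comp ψ` is
proper. [cite: MochizukiSemiAnbd2006, Def. 2.2(i) p.23] -/
theorem Hom.IsFiniteEtaleCoveringOf.isProper_comp {φ : Hom 𝒢 ℋ} {ψ : Hom ℋ 𝒦} {B : ℋ.BObj}
    {A : 𝒦.BObj} (hφ : φ.IsFiniteEtaleCoveringOf B) (hψ : ψ.IsFiniteEtaleCoveringOf A) :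
    SemiGraph.IsProper (φ.comp ψ).base :=
  SemiGraph.IsProper.comp hφ.1 hψ.1

end SemiGraphOfAnabelioids

end Literature.AnabelianGeometry.SemiGraphs
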